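import Literature.MathematicalPhysics.StatisticalMechanics.SquareLatticeEdgeIsoperimetry
import HarnessLib

/-!
# Sections of edge-isoperimetric minimizers are minimizers: the rearrangement argument of
# Mainini–Schmidt 2020 (Proposition 3.2 / Corollary 3.3) PROVED — Corollary 3.3 a THEOREM in `ℤ²` and `ℤ³`

Topic `Literature/MathematicalPhysics/StatisticalMechanics`, third file of the edge-isoperimetric
story `EdgeIsoperimetricFluctuations.lean` (Mainini–Piovano–Schmidt–Stefanelli 2019 / Mainini–Schmidt
2020, vendored as NAMED FACTS, among them `MaininiSchmidt2020_cor33` "every `(d−1)`-dimensional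
section of an `EIP^d` minimizer is an `EIP^{d−1}` minimizer") and `SquareLatticeEdgeIsoperimetry.lean`
(the problem in `ℤ²` SOLVED: `EIP²(n) = 2⌈2√n⌉`, daisies).  Cell `crystal3d-full` (D-0046),
literature-typing layer D-0088 (4), seat `littype-FC1-1` (gen 3).  Everything below is a theorem;
no named facts.  It makes the `d = 2` and `d = 3` instances of the fact `MaininiSchmidt2020_cor33`
tree theorems (`MaininiSchmidt2020_cor33_two`, `MaininiSchmidt2020_cor33_three`): in the CUBIC
LATTICE `ℤ³` of [MPSS19] every planar section ("`z`-level") of an edge-isoperimetric minimizer is a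
planar minimizer, hence a set with exactly `2⌈2√m⌉` boundary pairs, convex by rows and columns.

## Sources, as printed

**[MS20]** E. Mainini, B. Schmidt, *Maximal fluctuations around the Wulff shape for edge-isoperimetric
sets in `ℤ^d`: a sharp scaling law*, Comm. Math. Phys. 380 (2020) 947–971 = arXiv:2003.01679
[MaininiSchmidt2020] (held, store key `paper:arxiv-2003.01679`, tex chunk p. 9 = §3):
* **Proposition 3.2 (Decreasing rearrangement).** "Let `C ∈ ℤ^d` be a bounded nonempty set. Let
  `s ∈ {1,…,d}` and `k ∈ ℤ`. Let `K_s := {k₁,…,k_n}` denote the finite strictly increasing sequence of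
  integers such that `S_{s,k}(C) ≠ ∅ ⟺ k ∈ K_s`. Let `σ : {1,…,n} → K_s` be a bijection such that
  `#S_{s,σ(i)}(C) ≥ #S_{s,σ(j)}(C)` for any `1 ≤ i ≤ j ≤ n`.  Let `D^{(d−1)}_{s,k}` be the
  `(d−1)`-dimensional daisy with the same cardinality as `S_{s,k}(C)`. Finally, let `C_s ⊂ ℤ^d` denote
  the decreasing rearrangement of `C` in the `e_s` direction, i.e., the unique configuration whose
  nonempty sections orthogonal to `e_s` are given by `P S_{s,k}(C_s) = D^{(d−1)}_{s,σ(k)}`, `k = 1,…,n`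
  […]. Then `#Θ_d(C_s) ≤ #Θ_d(C)`."  Proof: "we have `b(D^{(d−1)}_{s,k}) ≥ b(S_{s,k}(C))`, since
  daisies minimize the edge perimeter […]. This shows that the total number of bonds in directions
  that are orthogonal to `e_s` does not increase after the rearrangement. […] By counting the bonds in
  the `e_s` direction as sum of bonds between couples of consecutive sections, we have
  `b_s(C) ≤ Σ_{i=2}^n min{f(k_{i−1}), f(k_i)} ≤ … = b_s(C_s)`".
* **Corollary 3.3.** "Let `C` be an `EIP^d` minimizer. Then each `(d−1)`-dimensional section is an
  `EIP^{d−1}` minimizer."  Proof: "If `S_{s,k}(C)` were not an `EIP^{d−1}` minimizer, then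
  `#Θ_{d−1}(S_{s,k}(C)) > #Θ_{d−1}(D^{(d−1)}_{s,k})` and the above proof shows `#Θ_d(C_s) < #Θ_d(C)`."
* The `(d−1)`-dimensional daisies are the nested family of `EIP^{d−1}` minimizers of Theorem 2.2
  (Ahlswede–Bezrukov: "So in particular one obtains a nested sequence of solutions for any given
  cardinality", p. 5).

**[MPSS19]** E. Mainini, P. Piovano, B. Schmidt, U. Stefanelli, *`N^{3/4}` law in the cubic lattice*,
J. Stat. Phys. 176 (2019) 1480–1499 = arXiv:1807.00811 [MaininiPiovanoSchmidtStefanelli2019] (held,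
`paper:arxiv-1807.00811`, p. 4 = §2): the `z`-levels `C_n(·,·,z) := C_n ∩ {k₁e₁ + k₂e₂ + z e₃}` of a
configuration in `ℤ³`; **Definition 2.2 (cuboidification), step (i)**: replace every `z`-level of a
minimizer `M_n` by "the 2-dimensional daisy `D_{d_z}`", `d_z := #M_n(·,·,z)`, the daisies being the
nested minimizers `D_d = R(s,s') ∪ L_e` of §2 — "It is clear that `M_n'` is still an EIP_n minimizer."

## What is formalised, and how

We prove the rearrangement inequality WITHOUT the reordering `σ` of the levels (Corollary 3.3 does
not need it): given ANY nested family `D : ℕ → Finset (ℤ^n)` of `EIP^n` minimizers with `#D m = m`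
(`IsNestedMinimizerFamily D`), replace every slice `A_t = A ∩ {x₀ = t}` of a finite `A ⊂ ℤ^{n+1}` by
`{t} × D(#A_t)` (`sliceRearrangement D A`).  Then (`card_boundaryPairs_sliceRearrangement_le`)
`#Θ(sliceRearrangement D A) ≤ #Θ(A)`, because
* ALL boundary pairs of `A` are either boundary pairs of a slice (directions `±e_{j+1}`) or vertical
  (`±e₀`) — `card_boundaryPairs_eq_sum_sliceAt_add`, the equality case of the tree's one-sided
  `sum_card_boundaryPairs_sliceAt_add_le` (`DiscreteIsoperimetry.lean`);
* slice by slice `#Θ_n(D(#A_t)) ≤ #Θ_n(A_t)` (minimality at equal cardinality) — the printed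
  "`b(D_{s,k}) ≥ b(S_{s,k}(C))`";
* the upward vertical boundary pairs based in the slice `t` are counted by `A_t ∖ A_{t+1}`
  (`card_vertBoundaryPairs_eq_sum`), and for NESTED sets `#(D a ∖ D a') = a ∸ a' ≤ #(A_t ∖ A_{t+1})`
  — the printed "`min{f(k_{i−1}), f(k_i)}`" count of vertical bonds.
If moreover `A` is an `EIP^{n+1}` minimizer, every slice `A_t` is an `EIP^n` minimizer
(`IsNestedMinimizerFamily.isEIPMinimizer_sliceAt`), and — transporting along the coordinate
permutation `Fin.cycleRange s` (`relabel`, `card_boundaryPairs_image_relabel`,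
`sliceAt_image_relabel_eq_latticeSection`) — so is every section `latticeSection s k A` in every
direction `s` (`IsNestedMinimizerFamily.isEIPMinimizer_latticeSection`).  Hence the printed
Corollary 3.3 in dimension `d = n + 1` is REDUCED to the existence of a nested family of `EIP^n`
minimizers, which we supply for `n = 1` (lattice intervals, `intervalConfig`) and `n = 2` (the nested
daisies `daisyOf m` of [MPSS19] §2, minimizers by `SquareLatticeEdgeIsoperimetry.lean`):
`MaininiSchmidt2020_cor33_two`, `MaininiSchmidt2020_cor33_three`.  For `n ≥ 3` the nested family is
the Ahlswede–Bezrukov order (not in the tree), so the general fact `MaininiSchmidt2020_cor33` stays a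
named fact; this file proves its content for the square and the cubic lattice.

WHAT IS NOT HERE: the reordering `σ` of Proposition 3.2 (levels sorted by decreasing cardinality) and
steps (ii)–(iii) of the cuboidification; the Ahlswede–Bezrukov order / daisies in `ℤ^d`, `d ≥ 3`;
anything about fcc/hcp.
-/

noncomputable section

open Finset

namespace Literature.MathematicalPhysics.StatisticalMechanics

open Literature.Probability.LatticeModels

variable {n : ℕ}

/-! ### Slicing by the first coordinate: every boundary pair is horizontal or vertical -/

section Slicing

variable (A : Finset (Site (n + 1)))

/-- Every boundary pair of `A ⊂ ℤ^{n+1}` is horizontal (direction `±e_{j+1}`: a lifted boundary pair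
of the slice through its base point) or vertical (direction `±e₀`). [cite: MaininiSchmidt2020, Proposition 3.2 (proof: bonds orthogonal to e_s vs bonds in the e_s direction)] -/
private theorem mem_horiz_or_vert {u : Site (n + 1) × Fin (n + 1) × Bool}
    (hu : u ∈ boundaryPairs A) :
    u ∈ horizBoundaryPairs A ∨ u ∈ vertBoundaryPairs A true ∨ u ∈ vertBoundaryPairs A false := by
  classical
  obtain ⟨x, i, b⟩ := u
  rw [mem_boundaryPairs] at hu
  obtain ⟨hx, hout⟩ := hu
  dsimp only at hx hout
  induction i using Fin.cases with
  | zero =>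
    cases b with
    | false =>
      right; right
      exact mem_filter.2 ⟨mem_boundaryPairs.2 ⟨hx, hout⟩, rfl⟩
    | true =>
      right; left
      exact mem_filter.2 ⟨mem_boundaryPairs.2 ⟨hx, hout⟩, rfl⟩
  | succ j =>
    left
    simp only [horizBoundaryPairs, mem_biUnion, mem_image]
    refine ⟨x 0, mem_image_of_mem _ hx, (Fin.tail x, j, b), ?_, ?_⟩
    · have h1 : Fin.tail x ∈ sliceAt A (x 0) := by
        rw [mem_sliceAt, Fin.cons_self_tail]; exact hx
      have h2 : Fin.tail x + unitStep j b ∉ sliceAt A (x 0) := by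
        rw [mem_sliceAt, cons_add_unitStep_succ, Fin.cons_self_tail]; exact hout
      exact mem_boundaryPairs.2 ⟨h1, h2⟩
    · simp [liftPair, Fin.cons_self_tail]

/-- Horizontal and vertical boundary pairs are distinct (their directions differ). [cite: MaininiSchmidt2020, Proposition 3.2 (proof)] -/
private theorem disjoint_horiz_vert (b : Bool) :
    Disjoint (horizBoundaryPairs A) (vertBoundaryPairs A b) := by
  rw [Finset.disjoint_left]
  intro u hu hu'
  refine dir_ne_zero_of_mem_horizBoundaryPairs hu ?_
  have h := (mem_filter.1 hu').2
  rw [Prod.ext_iff] at h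
  exact h.1

/-- Upward and downward vertical boundary pairs are distinct. [cite: MaininiSchmidt2020, Proposition 3.2 (proof)] -/
private theorem disjoint_vert_true_false :
    Disjoint (vertBoundaryPairs A true) (vertBoundaryPairs A false) := by
  rw [Finset.disjoint_left]
  intro u hu hu'
  have h1 := (mem_filter.1 hu).2
  have h2 := (mem_filter.1 hu').2
  rw [h1] at h2
  simp at h2

/-- **The boundary pairs of `A ⊂ ℤ^{n+1}` are exactly the lifted boundary pairs of its slices plus the
vertical ones** (the partition behind "bonds in directions orthogonal to `e_s`" / "bonds in the
direction of `e_s`"). [cite: MaininiSchmidt2020, Proposition 3.2 (proof)] -/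
theorem boundaryPairs_eq_horiz_union_vert :
    boundaryPairs A =
      horizBoundaryPairs A ∪ vertBoundaryPairs A true ∪ vertBoundaryPairs A false := by
  refine Subset.antisymm (fun u hu => ?_)
    (union_subset (union_subset horizBoundaryPairs_subset (vertBoundaryPairs_subset _))
      (vertBoundaryPairs_subset _))
  rcases mem_horiz_or_vert A hu with h | h | h
  · exact mem_union_left _ (mem_union_left _ h)
  · exact mem_union_left _ (mem_union_right _ h)
  · exact mem_union_right _ h

/-- **`#Θ_{n+1}(A) = Σ_t #Θ_n(A_t) + #(upward vertical pairs) + #(downward vertical pairs)`** — the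
equality case of the tree's `sum_card_boundaryPairs_sliceAt_add_le`. [cite: MaininiSchmidt2020, Proposition 3.2 (proof: horizontal and vertical bond counts)] -/
theorem card_boundaryPairs_eq_sum_sliceAt_add :
    #(boundaryPairs A) = ∑ t ∈ firstCoords A, #(boundaryPairs (sliceAt A t)) +
      #(vertBoundaryPairs A true) + #(vertBoundaryPairs A false) := by
  classical
  rw [boundaryPairs_eq_horiz_union_vert A,
    card_union_of_disjoint
      (disjoint_union_left.2 ⟨disjoint_horiz_vert A false, disjoint_vert_true_false A⟩),
    card_union_of_disjoint (disjoint_horiz_vert A true), card_horizBoundaryPairs]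

/-- **Vertical boundary pairs are counted slice against neighbouring slice**: the boundary pairs of
direction `(e₀, b)` based in the slice `t` correspond to the points of `A_t ∖ A_{t±1}` (`+` for the
upward sense `b = true`), so `#(vertical pairs of sense b) = Σ_t #(A_t ∖ A_{t±1})` — the quantity the
source bounds by "`min{f(k_{i−1}), f(k_i)}`" bonds between consecutive sections. [cite: MaininiSchmidt2020, Proposition 3.2 (proof: b_s(C) as a sum over consecutive sections)] -/
theorem card_vertBoundaryPairs_eq_sum (b : Bool) :
    #(vertBoundaryPairs A b) =
      ∑ t ∈ firstCoords A, #(sliceAt A t \ sliceAt A (t + if b then 1 else -1)) := by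
  classical
  rw [card_eq_sum_card_fiberwise (f := fun u : Site (n + 1) × Fin (n + 1) × Bool => u.1 0)
    (s := vertBoundaryPairs A b) (t := firstCoords A) ?_]
  · refine sum_congr rfl fun t _ => ?_
    refine card_bij' (fun u _ => Fin.tail u.1)
      (fun y _ => ((Fin.cons t y : Site (n + 1)), (0 : Fin (n + 1)), b)) ?_ ?_ ?_ ?_
    · intro u hu
      obtain ⟨x, i, b'⟩ := u
      rw [mem_filter] at hu
      obtain ⟨hu, hut⟩ := hu
      obtain ⟨hbp, hdir⟩ := mem_filter.1 hu
      simp only [Prod.mk.injEq] at hdir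
      obtain ⟨rfl, rfl⟩ := hdir
      rw [mem_boundaryPairs] at hbp
      dsimp only at hbp hut ⊢
      rw [mem_sdiff, mem_sliceAt, mem_sliceAt, cons_add_unitStep_zero, ← hut, Fin.cons_self_tail]
      exact hbp
    · intro y hy
      rw [mem_sdiff, mem_sliceAt, mem_sliceAt, cons_add_unitStep_zero] at hy
      refine mem_filter.2 ⟨mem_filter.2 ⟨mem_boundaryPairs.2 hy, rfl⟩, ?_⟩
      simp
    · intro u hu
      obtain ⟨x, i, b'⟩ := u
      rw [mem_filter] at hu
      obtain ⟨hu, hut⟩ := hu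
      obtain ⟨-, hdir⟩ := mem_filter.1 hu
      simp only [Prod.mk.injEq] at hdir
      obtain ⟨rfl, rfl⟩ := hdir
      dsimp only at hut ⊢
      rw [← hut, Fin.cons_self_tail]
    · intro y _
      simp
  · intro u hu
    have h := (mem_filter.1 (mem_coe.1 hu)).1
    rw [mem_boundaryPairs] at h
    exact mem_coe.2 (mem_image_of_mem _ h.1)

/-- A height not occupied by `A` has an empty slice. [cite: MaininiSchmidt2020, Proposition 3.2 (the set K_s of nonempty sections)] -/
theorem sliceAt_eq_empty_of_not_mem {t : ℤ} (ht : t ∉ firstCoords A) : sliceAt A t = ∅ := by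
  refine eq_empty_of_forall_notMem fun y hy => ht ?_
  exact mem_image.2 ⟨_, mem_sliceAt.1 hy, Fin.cons_zero _ _⟩

end Slicing

/-! ### The rearrangement along the first coordinate by a nested family of minimizers -/

section Rearrangement

/-- A **nested family of minimizers** in `ℤ^n`: for every cardinality `m` an `EIP^n` minimizer `D m`
with `#(D m) = m`, increasing in `m` — the rôle played in the sources by the daisies (`ℤ²`,
[MPSS19] §2) and by the initial segments of the Ahlswede–Bezrukov order (`ℤ^d`, [MS20] Theorem 2.2:
"one obtains a nested sequence of solutions for any given cardinality").
[cite: MaininiSchmidt2020, Theorem 2.2 and Proposition 3.2 (the daisies D^{(d-1)}_{s,k})] -/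
structure IsNestedMinimizerFamily (D : ℕ → Finset (Site n)) : Prop where
  /-- `D m` has exactly `m` points. -/
  card_eq : ∀ m, #(D m) = m
  /-- The family is increasing. -/
  mono : Monotone D
  /-- Every member is an `EIP^n` minimizer. -/
  isEIPMinimizer : ∀ m, IsEIPMinimizer (D m)

variable (D : ℕ → Finset (Site n))

/-- The **rearrangement of `A ⊂ ℤ^{n+1}` along `e₀` by the family `D`**: every non-empty slice
`A_t = A ∩ {x₀ = t}` is replaced by `{t} × D(#A_t)` (the printed decreasing rearrangement `C_s`,
without the reordering of the levels). [cite: MaininiSchmidt2020, Proposition 3.2 (C_s); MaininiPiovanoSchmidtStefanelli2019, Definition 2.2 (i)] -/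
def sliceRearrangement (A : Finset (Site (n + 1))) : Finset (Site (n + 1)) :=
  (firstCoords A).biUnion fun t => (D #(sliceAt A t)).image (Fin.cons t)

variable {D}

/-- Membership in the rearrangement: the height is an occupied height of `A` and the rest of the
point lies in the member of `D` of the size of that slice. [cite: MaininiSchmidt2020, Proposition 3.2 (C_s)] -/
theorem mem_sliceRearrangement {A : Finset (Site (n + 1))} {x : Site (n + 1)} :
    x ∈ sliceRearrangement D A ↔ x 0 ∈ firstCoords A ∧ Fin.tail x ∈ D #(sliceAt A (x 0)) := by
  classical
  simp only [sliceRearrangement, mem_biUnion, mem_image]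
  constructor
  · rintro ⟨t, ht, y, hy, rfl⟩
    simp only [Fin.cons_zero, Fin.tail_cons]
    exact ⟨ht, hy⟩
  · rintro ⟨h0, htail⟩
    exact ⟨x 0, h0, Fin.tail x, htail, Fin.cons_self_tail x⟩

/-- **The slices of the rearrangement are the prescribed minimizers**: `(sliceRearrangement D A)_t
= D(#A_t)` for every height `t` (for an unoccupied height both sides are empty, as `D 0 = ∅`).
[cite: MaininiSchmidt2020, Proposition 3.2 (P S_{s,k}(C_s) = D_{s,σ(k)})] -/
theorem sliceAt_sliceRearrangement (hD : IsNestedMinimizerFamily D) (A : Finset (Site (n + 1)))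
    (t : ℤ) : sliceAt (sliceRearrangement D A) t = D #(sliceAt A t) := by
  classical
  ext y
  rw [mem_sliceAt, mem_sliceRearrangement]
  simp only [Fin.cons_zero, Fin.tail_cons]
  by_cases ht : t ∈ firstCoords A
  · simp [ht]
  · have h0 : D #(sliceAt A t) = ∅ := by
      rw [← card_eq_zero, hD.card_eq, sliceAt_eq_empty_of_not_mem A ht, card_empty]
    simp [ht, h0]

/-- The rearrangement occupies the same heights as `A`. [cite: MaininiSchmidt2020, Proposition 3.2 (C_s)] -/
theorem firstCoords_sliceRearrangement (hD : IsNestedMinimizerFamily D) (A : Finset (Site (n + 1))) :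
    firstCoords (sliceRearrangement D A) = firstCoords A := by
  classical
  ext t
  constructor
  · intro ht
    obtain ⟨x, hx, rfl⟩ := mem_image.1 ht
    exact (mem_sliceRearrangement.1 hx).1
  · intro ht
    have hne : (D #(sliceAt A t)).Nonempty := by
      rw [← card_pos, hD.card_eq, card_pos]
      exact sliceAt_nonempty ht
    obtain ⟨y, hy⟩ := hne
    refine mem_image.2 ⟨Fin.cons t y, mem_sliceRearrangement.2 ?_, Fin.cons_zero _ _⟩
    simp only [Fin.cons_zero, Fin.tail_cons]
    exact ⟨ht, hy⟩

/-- **The rearrangement has as many points as `A`** (`#D(#A_t) = #A_t` slice by slice).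
[cite: MaininiSchmidt2020, Proposition 3.2 (C_s has the cardinality of C)] -/
theorem card_sliceRearrangement (hD : IsNestedMinimizerFamily D) (A : Finset (Site (n + 1))) :
    #(sliceRearrangement D A) = #A := by
  classical
  rw [sliceRearrangement, card_biUnion]
  · rw [card_eq_sum_card_sliceAt (A := A)]
    refine sum_congr rfl fun t _ => ?_
    rw [card_image_of_injective _
      ((Fin.cons_injective2 (α := fun _ : Fin (n + 1) => ℤ)).right t), hD.card_eq]
  · intro t _ t' _ htt'
    rw [Function.onFun, Finset.disjoint_left]
    intro x hx hx'
    obtain ⟨y, -, rfl⟩ := mem_image.1 hx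
    obtain ⟨y', -, h⟩ := mem_image.1 hx'
    have h0 := congrFun h 0
    simp only [Fin.cons_zero] at h0
    exact htt' h0.symm

/-- For a nested family with `#D m = m`: `#(D a ∖ D a') = a ∸ a'` (truncated subtraction) — nested
sets realise the MINIMAL possible number `#S − #S'` of points of `S` not in `S'`; this is the
monotonicity "`min{f(k_{i−1}), f(k_i)}`" of the vertical bond count under rearrangement.
[cite: MaininiSchmidt2020, Proposition 3.2 (proof: b_s(C) ≤ Σ min{f(k_{i-1}), f(k_i)} = b_s(C_s))] -/
theorem IsNestedMinimizerFamily.card_sdiff (hD : IsNestedMinimizerFamily D) (a a' : ℕ) :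
    #(D a \ D a') = a - a' := by
  rcases le_total a a' with h | h
  · rw [sdiff_eq_empty_iff_subset.2 (hD.mono h), card_empty, Nat.sub_eq_zero_of_le h]
  · rw [card_sdiff_of_subset (hD.mono h), hD.card_eq, hD.card_eq]

/-- **The rearrangement inequality** ([MS20] Proposition 3.2 without the reordering of the levels;
[MPSS19] Definition 2.2 (i)): replacing every slice of `A ⊂ ℤ^{n+1}` by the nested `EIP^n` minimizer
of the same cardinality does not increase the edge perimeter,
`#Θ_{n+1}(sliceRearrangement D A) ≤ #Θ_{n+1}(A)` — slice perimeters do not increase by minimality,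
vertical pairs do not increase by nestedness. [cite: MaininiSchmidt2020, Proposition 3.2; MaininiPiovanoSchmidtStefanelli2019, Definition 2.2 (i)] -/
theorem card_boundaryPairs_sliceRearrangement_le (hD : IsNestedMinimizerFamily D)
    (A : Finset (Site (n + 1))) :
    #(boundaryPairs (sliceRearrangement D A)) ≤ #(boundaryPairs A) := by
  classical
  rw [card_boundaryPairs_eq_sum_sliceAt_add (sliceRearrangement D A),
    card_boundaryPairs_eq_sum_sliceAt_add A, card_vertBoundaryPairs_eq_sum,
    card_vertBoundaryPairs_eq_sum, card_vertBoundaryPairs_eq_sum A, card_vertBoundaryPairs_eq_sum A,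
    firstCoords_sliceRearrangement hD]
  simp only [sliceAt_sliceRearrangement hD]
  refine add_le_add (add_le_add (sum_le_sum fun t _ => ?_) (sum_le_sum fun t _ => ?_))
    (sum_le_sum fun t _ => ?_)
  · exact hD.isEIPMinimizer _ _ (hD.card_eq _).symm
  · rw [hD.card_sdiff]; exact le_card_sdiff _ _
  · rw [hD.card_sdiff]; exact le_card_sdiff _ _

/-- **Slices of minimizers are minimizers, given a nested family** (the contradiction argument of
[MS20] Corollary 3.3 along `e₀`): if `A ⊂ ℤ^{n+1}` is an `EIP^{n+1}` minimizer and `ℤ^n` carries a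
nested family of `EIP^n` minimizers, then every slice `A_t = A ∩ {x₀ = t}` (as a subset of `ℤ^n`) is
an `EIP^n` minimizer — otherwise the rearrangement would have strictly smaller edge perimeter at the
same cardinality. [cite: MaininiSchmidt2020, Corollary 3.3 (proof)] -/
theorem IsNestedMinimizerFamily.isEIPMinimizer_sliceAt (hD : IsNestedMinimizerFamily D)
    {A : Finset (Site (n + 1))} (hA : IsEIPMinimizer A) (t : ℤ) : IsEIPMinimizer (sliceAt A t) := by
  classical
  by_contra hcon
  have ht : t ∈ firstCoords A := by
    by_contra ht
    rw [sliceAt_eq_empty_of_not_mem A ht] at hcon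
    exact hcon isEIPMinimizer_empty
  obtain ⟨C', hC', hlt⟩ : ∃ C' : Finset (Site n), #C' = #(sliceAt A t) ∧
      #(boundaryPairs C') < #(boundaryPairs (sliceAt A t)) := by
    by_contra h
    push Not at h
    exact hcon fun C' hC' => h C' hC'
  -- the rearrangement has strictly fewer boundary pairs
  have hstrict : #(boundaryPairs (sliceRearrangement D A)) < #(boundaryPairs A) := by
    rw [card_boundaryPairs_eq_sum_sliceAt_add (sliceRearrangement D A),
      card_boundaryPairs_eq_sum_sliceAt_add A, card_vertBoundaryPairs_eq_sum,
      card_vertBoundaryPairs_eq_sum, card_vertBoundaryPairs_eq_sum A, card_vertBoundaryPairs_eq_sum A,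
      firstCoords_sliceRearrangement hD]
    simp only [sliceAt_sliceRearrangement hD]
    refine add_lt_add_of_lt_of_le (add_lt_add_of_lt_of_le (sum_lt_sum (fun t' _ => ?_) ⟨t, ht, ?_⟩)
      (sum_le_sum fun t' _ => ?_)) (sum_le_sum fun t' _ => ?_)
    · exact hD.isEIPMinimizer _ _ (hD.card_eq _).symm
    · exact lt_of_le_of_lt (hD.isEIPMinimizer _ C' (by rw [hC', hD.card_eq])) hlt
    · rw [hD.card_sdiff]; exact le_card_sdiff _ _
    · rw [hD.card_sdiff]; exact le_card_sdiff _ _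
  have hmin := hA (sliceRearrangement D A) (card_sliceRearrangement hD A)
  omega

end Rearrangement

/-! ### Transport along a permutation of the coordinates: sections in every direction -/

section Relabel

variable {d : ℕ}

/-- Relabelling the coordinates of `ℤ^d` by a permutation `σ` of the axes: `(relabel σ x) i = x (σ i)`
(a lattice symmetry; used to move the section direction `e_s` to the front). [cite: MaininiSchmidt2020, Definition 2.11 (sections S_{s,k} in every direction s, identified with ℤ^{d-1} by P)] -/
def relabel (σ : Equiv.Perm (Fin d)) (x : Site d) : Site d := fun i => x (σ i)

/-- `relabel σ⁻¹ ∘ relabel σ = id`. [cite: MaininiSchmidt2020, Definition 2.11] -/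
theorem relabel_symm_relabel (σ : Equiv.Perm (Fin d)) (x : Site d) :
    relabel σ.symm (relabel σ x) = x := by
  funext i; simp [relabel]

/-- `relabel σ ∘ relabel σ⁻¹ = id`. [cite: MaininiSchmidt2020, Definition 2.11] -/
theorem relabel_relabel_symm (σ : Equiv.Perm (Fin d)) (x : Site d) :
    relabel σ (relabel σ.symm x) = x := by
  funext i; simp [relabel]

/-- Relabelling is injective. [cite: MaininiSchmidt2020, Definition 2.11] -/
theorem relabel_injective (σ : Equiv.Perm (Fin d)) : Function.Injective (relabel (d := d) σ) :=
  fun x y h => by rw [← relabel_symm_relabel σ x, h, relabel_symm_relabel]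

/-- Relabelling maps lattice steps to lattice steps: `relabel σ (x ± eᵢ) = relabel σ x ± e_{σ⁻¹ i}`.
[cite: MaininiSchmidt2020, Definition 2.11] -/
theorem relabel_add_unitStep (σ : Equiv.Perm (Fin d)) (x : Site d) (i : Fin d) (b : Bool) :
    relabel σ (x + unitStep i b) = relabel σ x + unitStep (σ.symm i) b := by
  funext k
  simp only [relabel, Pi.add_apply, unitStep_apply, Equiv.apply_eq_iff_eq_symm_apply]

/-- **The edge perimeter is invariant under relabelling the axes**: `(x, ±eᵢ) ↦ (relabel σ x, ±e_{σ⁻¹ i})`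
is a bijection between the boundary pairs of `A` and those of its relabelled copy.
[cite: MaininiSchmidt2020, §1 (Θ_d is defined through |x − y| = 1, invariant under lattice symmetries)] -/
theorem card_boundaryPairs_image_relabel (σ : Equiv.Perm (Fin d)) (A : Finset (Site d)) :
    #(boundaryPairs (A.image (relabel σ))) = #(boundaryPairs A) := by
  classical
  symm
  refine card_bij' (fun u _ => (relabel σ u.1, σ.symm u.2.1, u.2.2))
    (fun v _ => (relabel σ.symm v.1, σ v.2.1, v.2.2)) ?_ ?_ ?_ ?_
  · rintro ⟨x, i, b⟩ hu
    rw [mem_boundaryPairs] at hu ⊢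
    dsimp only at hu ⊢
    refine ⟨mem_image_of_mem _ hu.1, fun h => hu.2 ?_⟩
    rw [← relabel_add_unitStep] at h
    obtain ⟨y, hy, hyx⟩ := mem_image.1 h
    rw [← relabel_injective σ hyx]
    exact hy
  · rintro ⟨y, j, b⟩ hv
    rw [mem_boundaryPairs] at hv ⊢
    dsimp only at hv ⊢
    obtain ⟨hv1, hv2⟩ := hv
    obtain ⟨x, hx, hxy⟩ := mem_image.1 hv1
    have hx' : relabel σ.symm y = x := by rw [← hxy, relabel_symm_relabel]
    rw [hx']
    refine ⟨hx, fun h => hv2 ?_⟩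
    have h' : relabel σ (x + unitStep (σ j) b) = y + unitStep j b := by
      rw [relabel_add_unitStep, hxy, Equiv.symm_apply_apply]
    rw [← h']
    exact mem_image_of_mem _ h
  · rintro ⟨x, i, b⟩ _
    simp [relabel_symm_relabel]
  · rintro ⟨y, j, b⟩ _
    simp [relabel_relabel_symm]

/-- **Relabelled copies of minimizers are minimizers** (relabelling is a bijection of `ℤ^d`
preserving cardinalities and edge perimeters). [cite: MaininiSchmidt2020, §1 (EIP^d minimizers; lattice symmetries)] -/
theorem IsEIPMinimizer.image_relabel (σ : Equiv.Perm (Fin d)) {C : Finset (Site d)}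
    (hC : IsEIPMinimizer C) : IsEIPMinimizer (C.image (relabel σ)) := by
  classical
  intro C' hC'
  have hcomp : relabel σ ∘ relabel σ.symm = id := funext (relabel_relabel_symm σ)
  have h1 : (C'.image (relabel σ.symm)).image (relabel σ) = C' := by
    rw [image_image, hcomp, image_id]
  have h2 : #(C'.image (relabel σ.symm)) = #C := by
    rw [card_image_of_injective _ (relabel_injective _), hC',
      card_image_of_injective _ (relabel_injective _)]
  calc #(boundaryPairs (C.image (relabel σ))) = #(boundaryPairs C) :=
        card_boundaryPairs_image_relabel σ C
    _ ≤ #(boundaryPairs (C'.image (relabel σ.symm))) := hC _ h2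
    _ = #(boundaryPairs ((C'.image (relabel σ.symm)).image (relabel σ))) :=
        (card_boundaryPairs_image_relabel σ _).symm
    _ = #(boundaryPairs C') := by rw [h1]

end Relabel

section Sections

/-- Moving the axis `e_s` to the front: relabelling by `(Fin.cycleRange s)⁻¹` sends `x` to
`(x_s, x with the s-th coordinate removed)` — the identification `P` of the hyperplane `{x_s = k}`
with `ℤ^{d−1}`. [cite: MaininiSchmidt2020, Definition 2.11 (P(z_1,…,z_d) = (z_1,…,z_{s-1},z_{s+1},…,z_d))] -/
theorem relabel_cycleRange_symm_eq_cons (s : Fin (n + 1)) (x : Site (n + 1)) :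
    relabel (Fin.cycleRange s).symm x = Fin.cons (x s) (Fin.removeNth s x) := by
  funext k
  refine Fin.cases ?_ (fun j => ?_) k
  · simp [relabel]
  · simp [relabel, Fin.removeNth]

/-- **Sections are slices of the relabelled set**: the section `S_{s,k}(C) = C ∩ {x_s = k}` (as a
subset of `ℤ^n`, `latticeSection s k C`) is the slice at height `k` of the copy of `C` with the axis
`e_s` moved to the front. [cite: MaininiSchmidt2020, Definition 2.11 and Proposition 3.2] -/
theorem sliceAt_image_relabel_eq_latticeSection (s : Fin (n + 1)) (k : ℤ)
    (C : Finset (Site (n + 1))) :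
    sliceAt (C.image (relabel (Fin.cycleRange s).symm)) k = latticeSection s k C := by
  classical
  ext y
  rw [mem_sliceAt, mem_image, latticeSection, mem_image]
  constructor
  · rintro ⟨x, hx, hxy⟩
    rw [relabel_cycleRange_symm_eq_cons, Fin.cons_inj] at hxy
    exact ⟨x, mem_filter.2 ⟨hx, hxy.1⟩, hxy.2⟩
  · rintro ⟨x, hx, rfl⟩
    obtain ⟨hx, hxs⟩ := mem_filter.1 hx
    exact ⟨x, hx, by rw [relabel_cycleRange_symm_eq_cons, hxs]⟩

variable {D : ℕ → Finset (Site n)}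

/-- **[MS20] Corollary 3.3 REDUCED to a nested family of minimizers one dimension down.**  If `ℤ^n`
carries a nested family of `EIP^n` minimizers (one for each cardinality), then every section
`S_{s,k}(C) = C ∩ {x_s = k}`, in every direction `s`, of every `EIP^{n+1}` minimizer `C ⊂ ℤ^{n+1}` is
an `EIP^n` minimizer.  (The source obtains the nested family in every dimension from the
Ahlswede–Bezrukov order, Theorem 2.2; below it is supplied explicitly for `n = 1, 2`.)
[cite: MaininiSchmidt2020, Corollary 3.3 (with Proposition 3.2 and Theorem 2.2)] -/
theorem IsNestedMinimizerFamily.isEIPMinimizer_latticeSection (hD : IsNestedMinimizerFamily D)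
    {C : Finset (Site (n + 1))} (hC : IsEIPMinimizer C) (s : Fin (n + 1)) (k : ℤ) :
    IsEIPMinimizer (latticeSection s k C) := by
  rw [← sliceAt_image_relabel_eq_latticeSection]
  exact hD.isEIPMinimizer_sliceAt (hC.image_relabel _) k

end Sections

/-! ### Dimension one: lattice intervals are nested minimizers ⇒ Corollary 3.3 in `ℤ²` -/

section DimOne

/-- The lattice interval `{1, …, m} ⊂ ℤ¹` (the one-dimensional "daisy" / Wulff shape `W_m`).
[cite: MaininiSchmidt2020, §1 (W_n = {1,…,⌊n^{1/d}⌋}^d; d = 1)] -/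
def intervalConfig (m : ℕ) : Finset (Site 1) := Fintype.piFinset fun _ : Fin 1 => Icc (1 : ℤ) m

/-- Membership in the lattice interval, in coordinates. [cite: MaininiSchmidt2020, §1 (W_n, d = 1)] -/
theorem mem_intervalConfig {m : ℕ} {x : Site 1} : x ∈ intervalConfig m ↔ 1 ≤ x 0 ∧ x 0 ≤ m := by
  simp [intervalConfig, Fintype.mem_piFinset, Fin.forall_fin_one]

/-- `#{1, …, m} = m`. [cite: MaininiSchmidt2020, §1 (W_n, d = 1)] -/
theorem card_intervalConfig (m : ℕ) : #(intervalConfig m) = m := by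
  simp [intervalConfig, Fintype.card_piFinset, Int.card_Icc]

/-- Lattice intervals are (trivially) line-convex. [cite: MaininiSchmidt2020, §1 (W_n, d = 1)] -/
theorem isLineConvex_intervalConfig (m : ℕ) (i : Fin 1) : IsLineConvex i (intervalConfig m) := by
  intro x hx y hy _ z _ hxz hzy
  rw [mem_intervalConfig] at hx hy ⊢
  have hi : i = 0 := Subsingleton.elim _ _
  subst hi
  omega

/-- A non-empty lattice interval has exactly two boundary pairs (its two ends).
[cite: MaininiSchmidt2020, §1 (EIP^d(n); d = 1)] -/
theorem card_boundaryPairs_intervalConfig {m : ℕ} (hm : 1 ≤ m) :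
    #(boundaryPairs (intervalConfig m)) = 2 := by
  classical
  have h := card_boundaryPairs_eq_two_mul_sum_card_dropCoord_of_isLineConvex (intervalConfig m)
    (isLineConvex_intervalConfig m)
  rw [h, Fin.sum_univ_one]
  have hne : (dropCoord 0 (intervalConfig m)).Nonempty := by
    have h' : (intervalConfig m).Nonempty := by
      rw [← card_pos, card_intervalConfig]; exact hm
    obtain ⟨x, hx⟩ := h'
    exact ⟨_, mem_dropCoord_iff.2 ⟨x, hx, rfl⟩⟩
  have h1 : #(dropCoord 0 (intervalConfig m)) = 1 :=
    le_antisymm (card_le_one.2 fun a _ b _ => Subsingleton.elim a b) (card_pos.2 hne)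
  rw [h1]

/-- **Lattice intervals are `EIP¹` minimizers** (every non-empty finite subset of `ℤ` has at least two
boundary pairs, `two_le_card_boundaryPairs_one`). [cite: MaininiSchmidt2020, §1 (EIP^d minimizers; d = 1: intervals)] -/
theorem isEIPMinimizer_intervalConfig (m : ℕ) : IsEIPMinimizer (intervalConfig m) := by
  rcases Nat.eq_zero_or_pos m with rfl | hm
  · have h0 : intervalConfig 0 = ∅ := by rw [← card_eq_zero, card_intervalConfig]
    rw [h0]; exact isEIPMinimizer_empty
  · intro C' hC'
    rw [card_boundaryPairs_intervalConfig hm]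
    rw [card_intervalConfig] at hC'
    exact two_le_card_boundaryPairs_one C' (card_pos.1 (by omega))

/-- Lattice intervals are nested. [cite: MaininiSchmidt2020, Theorem 2.2 (nested solutions; d = 1)] -/
theorem intervalConfig_mono : Monotone intervalConfig := by
  intro m m' h x hx
  rw [mem_intervalConfig] at hx ⊢
  omega

/-- **The lattice intervals form a nested family of `EIP¹` minimizers.**
[cite: MaininiSchmidt2020, Theorem 2.2 (nested solutions; d = 1)] -/
theorem isNestedMinimizerFamily_intervalConfig : IsNestedMinimizerFamily intervalConfig :=
  ⟨card_intervalConfig, intervalConfig_mono, isEIPMinimizer_intervalConfig⟩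

/-- **[MS20] Corollary 3.3 for `d = 2`, PROVED**: every one-dimensional section (row or column, as a
subset of `ℤ`) of an `EIP²` minimizer `C ⊂ ℤ²` is an `EIP¹` minimizer.  (The `d = 2` instance of the
named fact `MaininiSchmidt2020_cor33` of `EdgeIsoperimetricFluctuations.lean`; cf.
`IsEIPMinimizer.isLineConvex`: the rows and columns are intervals.) [cite: MaininiSchmidt2020, Corollary 3.3 (d = 2)] -/
theorem MaininiSchmidt2020_cor33_two (C : Finset (Site 2)) (hC : IsEIPMinimizer C) (s : Fin 2)
    (k : ℤ) : IsEIPMinimizer (latticeSection s k C) :=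
  isNestedMinimizerFamily_intervalConfig.isEIPMinimizer_latticeSection hC s k

end DimOne

/-! ### Dimension two: the daisies are nested minimizers ⇒ Corollary 3.3 in the cubic lattice `ℤ³` -/

section DimTwo

/-- **The daisy with `m` points** `D_m = R(s, s') ∪ L_e` of [MPSS19] §2 (`s = ⌊√m⌋`, `r = m − s²`;
for `r < s`: `s' = s`, `e = r`, a partial row on top of the square; for `r ≥ s`: `s' = s + 1`,
`e = r − s`, a partial column to the right of `R(s, s+1)`) — for each `m` THE daisy of cardinality
`m` (the parameters are determined by `m`), growing with `m` square → row → column → next square.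
[cite: MaininiPiovanoSchmidtStefanelli2019, §2 (D_d := R(s,s') ∪ L_e with s' ∈ {s,s+1}, s·s'+e = d, e < s') and Definition 2.2 (i) (D_{d_z})] -/
def daisyOf (m : ℕ) : Finset (Site 2) :=
  if m - Nat.sqrt m ^ 2 < Nat.sqrt m then daisy (Nat.sqrt m) (Nat.sqrt m) (m - Nat.sqrt m ^ 2)
  else daisy (Nat.sqrt m) (Nat.sqrt m + 1) (m - Nat.sqrt m ^ 2 - Nat.sqrt m)

/-- Membership in `D_m`, in coordinates (`s = ⌊√m⌋`): the square `[1,s]²`, the top row `{x₁ = s+1}`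
up to `min(m − s², s)`, the right column `{x₀ = s+1}` up to `m − s² − s`.
[cite: MaininiPiovanoSchmidtStefanelli2019, §2 (daisies D_d)] -/
theorem mem_daisyOf {m : ℕ} {z : Site 2} :
    z ∈ daisyOf m ↔
      (1 ≤ z 0 ∧ z 0 ≤ Nat.sqrt m ∧ 1 ≤ z 1 ∧ z 1 ≤ Nat.sqrt m) ∨
        (z 1 = Nat.sqrt m + 1 ∧ 1 ≤ z 0 ∧ z 0 ≤ Nat.sqrt m ∧
          z 0 + ((Nat.sqrt m ^ 2 : ℕ) : ℤ) ≤ m) ∨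
        (z 0 = Nat.sqrt m + 1 ∧ 1 ≤ z 1 ∧
          z 1 + ((Nat.sqrt m ^ 2 : ℕ) : ℤ) + Nat.sqrt m ≤ m) := by
  have h1 := Nat.sqrt_le' m
  have h2 := Nat.lt_succ_sqrt' m
  unfold daisyOf
  set s := Nat.sqrt m with hs
  obtain ⟨q, hq⟩ : ∃ q, q = s ^ 2 := ⟨_, rfl⟩
  have e1 : (s + 1) ^ 2 = q + 2 * s + 1 := by rw [hq]; ring
  rw [e1] at h2
  rw [← hq] at h1 ⊢
  split_ifs with hr
  · rw [mem_daisy]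
    have hc : (((m - q : ℕ)) : ℤ) = (m : ℤ) - q := by push_cast [Nat.cast_sub h1]; ring
    omega
  · rw [mem_daisy]
    have hc : (((m - q - s : ℕ)) : ℤ) = (m : ℤ) - q - s := by
      rw [Nat.sub_sub, Nat.cast_sub (by omega)]; push_cast; ring
    omega

/-- **`#D_m = m`.** [cite: MaininiPiovanoSchmidtStefanelli2019, §2 (s·s' + e = d)] -/
theorem card_daisyOf (m : ℕ) : #(daisyOf m) = m := by
  have h1 := Nat.sqrt_le' m
  have h2 := Nat.lt_succ_sqrt' m
  unfold daisyOf
  set s := Nat.sqrt m with hs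
  obtain ⟨q, hq⟩ : ∃ q, q = s ^ 2 := ⟨_, rfl⟩
  have e1 : (s + 1) ^ 2 = q + 2 * s + 1 := by rw [hq]; ring
  have e2 : s * s = q := by rw [hq, sq]
  have e3 : s * (s + 1) = q + s := by rw [hq]; ring
  rw [e1] at h2
  rw [← hq] at h1 ⊢
  split_ifs with hr
  · rw [card_daisy, e2]; omega
  · rw [card_daisy, e3]; omega

/-- **The daisies are nested**: `D_m ⊆ D_{m+1}` (the next point is appended to the growing row,
resp. column, resp. starts the next one). [cite: MaininiPiovanoSchmidtStefanelli2019, §2 (daisies) and Definition 2.2 (i); MaininiSchmidt2020, Theorem 2.2 (nested sequence of solutions)] -/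
theorem daisyOf_subset_succ (m : ℕ) : daisyOf m ⊆ daisyOf (m + 1) := by
  intro z hz
  have h1 := Nat.sqrt_le' m
  have h2 := Nat.lt_succ_sqrt' m
  have h1' := Nat.sqrt_le' (m + 1)
  have h2' := Nat.lt_succ_sqrt' (m + 1)
  have hmono : Nat.sqrt m ≤ Nat.sqrt (m + 1) := Nat.sqrt_le_sqrt (Nat.le_succ m)
  rw [mem_daisyOf] at hz ⊢
  set s := Nat.sqrt m with hs
  set s' := Nat.sqrt (m + 1) with hs'
  obtain ⟨q, hq⟩ : ∃ q, q = s ^ 2 := ⟨_, rfl⟩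
  obtain ⟨q', hq'⟩ : ∃ q', q' = s' ^ 2 := ⟨_, rfl⟩
  have e1 : (s + 1) ^ 2 = q + 2 * s + 1 := by rw [hq]; ring
  have e2 : (s' + 1) ^ 2 = q' + 2 * s' + 1 := by rw [hq']; ring
  have e3 : (s + 2) ^ 2 = q + 4 * s + 4 := by rw [hq]; ring
  rw [e1] at h2
  rw [e2] at h2'
  rw [← hq] at h1 hz
  rw [← hq'] at h1' ⊢
  have hcases : (s' = s ∧ q' = q) ∨ (s' = s + 1 ∧ q' = q + 2 * s + 1) := by
    rcases Nat.lt_or_ge s' (s + 2) with h | h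
    · rcases Nat.lt_or_ge s' (s + 1) with h' | h'
      · have hss : s' = s := by omega
        exact Or.inl ⟨hss, by rw [hq', hq, hss]⟩
      · have hss : s' = s + 1 := by omega
        exact Or.inr ⟨hss, by rw [hq', hss, ← e1]⟩
    · exfalso
      have h3 : (s + 2) ^ 2 ≤ s' ^ 2 := Nat.pow_le_pow_left h 2
      rw [e3, ← hq'] at h3
      omega
  rcases hcases with ⟨hss, hqq⟩ | ⟨hss, hqq⟩
  · rw [hss, hqq]; omega
  · rw [hss, hqq]; push_cast; omega

/-- The daisies increase with the cardinality. [cite: MaininiSchmidt2020, Theorem 2.2 (nested sequence of solutions; d = 2)] -/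
theorem daisyOf_mono : Monotone daisyOf := monotone_nat_of_le_succ daisyOf_subset_succ

/-- **Every `D_m` is an `EIP²` minimizer** (its edge perimeter is `2⌈2√m⌉ = EIP²(m)`, by
`card_boundaryPairs_daisy`, `ceil_two_sqrt_daisy` and `isEIPMinimizer_iff_card_boundaryPairs_eq` of
`SquareLatticeEdgeIsoperimetry.lean`). [cite: MaininiPiovanoSchmidtStefanelli2019, §2 (the daisies D_d are EIP² minimizers, recalled from [MPS14])] -/
theorem isEIPMinimizer_daisyOf (m : ℕ) : IsEIPMinimizer (daisyOf m) := by
  rcases Nat.eq_zero_or_pos m with rfl | hm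
  · have h0 : daisyOf 0 = ∅ := by rw [← card_eq_zero, card_daisyOf]
    rw [h0]; exact isEIPMinimizer_empty
  · have hs1 : 1 ≤ Nat.sqrt m := Nat.sqrt_pos.mpr hm
    have h1 := Nat.sqrt_le' m
    have h2 := Nat.lt_succ_sqrt' m
    rw [isEIPMinimizer_iff_card_boundaryPairs_eq, card_daisyOf]
    unfold daisyOf
    set s := Nat.sqrt m with hs
    obtain ⟨q, hq⟩ : ∃ q, q = s ^ 2 := ⟨_, rfl⟩
    have e1 : (s + 1) ^ 2 = q + 2 * s + 1 := by rw [hq]; ring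
    have e2 : s * s = q := by rw [hq, sq]
    have e3 : s * (s + 1) = q + s := by rw [hq]; ring
    rw [e1] at h2
    rw [← hq] at h1 ⊢
    split_ifs with hr
    · have hm' : s * s + (m - q) = m := by rw [e2]; omega
      have hc := ceil_two_sqrt_daisy hs1 (Or.inl rfl) hr
      rw [hm'] at hc
      rw [card_boundaryPairs_daisy hs1 (Or.inl rfl) hr, hc]
      split_ifs <;> omega
    · have hr' : m - q - s < s + 1 := by omega
      have hm' : s * (s + 1) + (m - q - s) = m := by rw [e3]; omega
      have hc := ceil_two_sqrt_daisy hs1 (Or.inr rfl) hr'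
      rw [hm'] at hc
      rw [card_boundaryPairs_daisy hs1 (Or.inr rfl) hr', hc]
      split_ifs <;> omega

/-- **The daisies `(D_m)_m` form a nested family of `EIP²` minimizers** — the input of the
cuboidification / decreasing rearrangement in `ℤ³`. [cite: MaininiPiovanoSchmidtStefanelli2019, §2 and Definition 2.2 (i); MaininiSchmidt2020, Theorem 2.2 (d = 2)] -/
theorem isNestedMinimizerFamily_daisyOf : IsNestedMinimizerFamily daisyOf :=
  ⟨card_daisyOf, daisyOf_mono, isEIPMinimizer_daisyOf⟩

/-- **[MS20] Corollary 3.3 for `d = 3` (the cubic lattice), PROVED**: every planar section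
`S_{s,k}(C) = C ∩ {x_s = k}` ("`z`-level" `C(·,·,z)` of [MPSS19], in any of the three directions) of
an edge-isoperimetric minimizer `C ⊂ ℤ³` is an `EIP²` minimizer.  (The `d = 3` instance of the named
fact `MaininiSchmidt2020_cor33` of `EdgeIsoperimetricFluctuations.lean`, via the rearrangement by
nested daisies — the content of "It is clear that `M_n'` is still an EIP_n minimizer" in the
cuboidification.) [cite: MaininiSchmidt2020, Corollary 3.3 (d = 3); MaininiPiovanoSchmidtStefanelli2019, Definition 2.2 (i)] -/
theorem MaininiSchmidt2020_cor33_three (C : Finset (Site 3)) (hC : IsEIPMinimizer C) (s : Fin 3)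
    (k : ℤ) : IsEIPMinimizer (latticeSection s k C) :=
  isNestedMinimizerFamily_daisyOf.isEIPMinimizer_latticeSection hC s k

/-- Corollary: **every planar section of a cubic-lattice minimizer with `m` points has edge perimeter
exactly `2⌈2√m⌉ = EIP²(m)`** (equivalently `⌊2m − 2√m⌋` unit bonds, [MPSS19] §2).
[cite: MaininiSchmidt2020, Corollary 3.3 (d = 3); MaininiPiovanoSchmidtStefanelli2019, §2 (#Θ₂ of planar minimizers = 2⌈2√d⌉)] -/
theorem card_boundaryPairs_latticeSection_three {C : Finset (Site 3)} (hC : IsEIPMinimizer C)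
    (s : Fin 3) (k : ℤ) :
    #(boundaryPairs (latticeSection s k C)) =
      2 * ⌈2 * Real.sqrt (#(latticeSection s k C) : ℝ)⌉₊ :=
  (isEIPMinimizer_iff_card_boundaryPairs_eq _).1 (MaininiSchmidt2020_cor33_three C hC s k)

/-- Corollary: **the planar sections of a cubic-lattice minimizer are convex by rows and columns**
(every lattice line of `ℤ³` meets an edge-isoperimetric minimizer in an interval, read inside the
coordinate plane containing it). [cite: MaininiSchmidt2020, Corollary 3.3 (d = 3, then d = 2); MaininiPiovanoStefanelli2014, Proposition 6.3] -/
theorem isLineConvex_latticeSection_three {C : Finset (Site 3)} (hC : IsEIPMinimizer C)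
    (s : Fin 3) (k : ℤ) (i : Fin 2) : IsLineConvex i (latticeSection s k C) :=
  (MaininiSchmidt2020_cor33_three C hC s k).isLineConvex i

end DimTwo

/-! ### Corollary: every lattice line of `ℤ³` meets a minimizer in an interval -/

section LineConvexThree

/-- Equal projections forgetting the coordinate `i` means equal coordinates off `i`. [cite: MaininiSchmidt2020, Definition 2.11 (the projection P)] -/
private theorem apply_eq_of_removeNth_eq {m : ℕ} {i : Fin (m + 1)} {x y : Site (m + 1)}
    (h : Fin.removeNth i x = Fin.removeNth i y) {c : Fin (m + 1)} (hc : c ≠ i) : x c = y c := by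
  obtain ⟨l, rfl⟩ := Fin.exists_succAbove_eq hc
  exact congrFun h l

/-- **Cubic-lattice minimizers are convex along every lattice line**: an `EIP³` minimizer
`C ⊂ ℤ³` is line-convex in each of the three directions (a line of direction `eᵢ` lies in a
coordinate plane `{x_s = k}`, `s ≠ i`, whose section is an `EIP²` minimizer, hence convex by rows and
columns) — the three-dimensional form of "ground states are convex by rows and columns".
[cite: MaininiSchmidt2020, Corollary 3.3 (d = 3 and d = 2); MaininiPiovanoStefanelli2014, Proposition 6.3] -/
theorem IsEIPMinimizer.isLineConvex_three {C : Finset (Site 3)} (hC : IsEIPMinimizer C)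
    (i : Fin 3) : IsLineConvex i C := by
  classical
  -- a coordinate plane containing the direction `eᵢ`: `i = s.succAbove j`
  obtain ⟨s, j, hsj⟩ : ∃ (s : Fin 3) (j : Fin 2), s.succAbove j = i := by
    fin_cases i
    · exact ⟨1, 0, by decide⟩
    · exact ⟨0, 0, by decide⟩
    · exact ⟨0, 1, by decide⟩
  subst hsj
  intro x hx y hy hxy z hzx hxz hzy
  have hsi : s ≠ s.succAbove j := (Fin.succAbove_ne s j).symm
  -- the three points lie in the plane `{x_s = x s}`
  have hys : y s = x s := (apply_eq_of_removeNth_eq hxy hsi).symm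
  have hzs : z s = x s := apply_eq_of_removeNth_eq hzx hsi
  have hx' : Fin.removeNth s x ∈ latticeSection s (x s) C :=
    mem_image.2 ⟨x, mem_filter.2 ⟨hx, rfl⟩, rfl⟩
  have hy' : Fin.removeNth s y ∈ latticeSection s (x s) C :=
    mem_image.2 ⟨y, mem_filter.2 ⟨hy, hys⟩, rfl⟩
  -- projections inside the plane
  have hproj : ∀ {u v : Site 3},
      Fin.removeNth (s.succAbove j) u = Fin.removeNth (s.succAbove j) v →
        Fin.removeNth j (Fin.removeNth s u) = Fin.removeNth j (Fin.removeNth s v) := by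
    intro u v h
    funext l
    simp only [Fin.removeNth]
    exact apply_eq_of_removeNth_eq h (Fin.succAbove_right_injective.ne (Fin.succAbove_ne j l))
  have hz' : Fin.removeNth s z ∈ latticeSection s (x s) C :=
    isLineConvex_latticeSection_three hC s (x s) j _ hx' _ hy' (hproj hxy) (Fin.removeNth s z)
      (hproj hzx) (by simpa [Fin.removeNth] using hxz) (by simpa [Fin.removeNth] using hzy)
  -- back to `ℤ³`
  obtain ⟨w, hw, hwz⟩ := mem_image.1 hz'
  obtain ⟨hwC, hws⟩ := mem_filter.1 hw
  have hw_eq : w = z := by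
    rw [← Fin.insertNth_self_removeNth s w, ← Fin.insertNth_self_removeNth s z, hwz, hws, hzs]
  rw [← hw_eq]
  exact hwC

end LineConvexThree

/-! ### What remains of the general fact: nested minimizers in every dimension -/

section Reduction

/-- **The named fact `MaininiSchmidt2020_cor33` (all dimensions) REDUCED to the existence of a
nested family of `EIP^n` minimizers in every `ℤ^n`** — i.e. to the Ahlswede–Bezrukov theorem behind
[MS20] Theorem 2.2 ("For each `n ∈ ℕ` the string of the first `n` elements in `ℕ^d` with respect to
the order `≺` is an `EIP^d` minimizer.  So in particular one obtains a nested sequence of solutions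
for any given cardinality"), which is not in the tree: once such families are exhibited for every
`n`, Corollary 3.3 holds in every dimension by `IsNestedMinimizerFamily.isEIPMinimizer_latticeSection`.
(For `n = 1, 2` the families are `intervalConfig`, `daisyOf` above.)
[cite: MaininiSchmidt2020, Corollary 3.3 with Theorem 2.2] -/
theorem MaininiSchmidt2020_cor33_of_nested
    (h : ∀ n : ℕ, ∃ D : ℕ → Finset (Site n), IsNestedMinimizerFamily D) :
    MaininiSchmidt2020_cor33 := by
  intro n C hC s k
  obtain ⟨D, hD⟩ := h n
  exact hD.isEIPMinimizer_latticeSection hC s k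

end Reduction

end Literature.MathematicalPhysics.StatisticalMechanics

end
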